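import Literature.NumberTheory.Transcendental.MultipleZetaDepthTwoProofs
import HarnessLib

/-!
# Multiple zeta values — Euler's decomposition (shuffle) formula for `ζ(2)ζ(3)`, `ζ(2)ζ(2)`, `ζ(2)ζ(4)`, `ζ(3)ζ(3)`

Sibling proof file of `Literature.NumberTheory.Transcendental.MultipleZeta` (theorems only: no
definition, no statement change, no named fact), continuing `MultipleZetaDepthTwoProofs.lean`.
In the decreasing convention `ζ(s₁, s₂) = ∑_{n₁ > n₂ ≥ 1} n₁^{-s₁} n₂^{-s₂}` of `multipleZeta` it
proves the two **shuffle relations** (Euler's decomposition formula, Eie 2013, Theorem 1.2.3: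
`ζ(p+1)ζ(q+1) = ∑_{|α| = p+q+1} (binom(α₂, q) + binom(α₂, p)) ζ(α₁, α₂ + 1)` in the increasing
convention, i.e. `… ζ(α₂ + 1, α₁)` here)

* `multipleZeta_two_mul_three_shuffle` — `ζ(2)ζ(3) = ζ(2,3) + 3 ζ(3,2) + 6 ζ(4,1)`
  (`p = 1`, `q = 2`: coefficients `binom(1,2)+binom(1,1) = 1`, `binom(2,2)+binom(2,1) = 3`,
  `binom(3,2)+binom(3,1) = 6`);
* `multipleZeta_two_mul_two_shuffle` — `ζ(2)ζ(2) = 2 ζ(2,2) + 4 ζ(3,1)` (`p = q = 1`), whence,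
  with the stuffle relation `ζ(2)² = 2 ζ(2,2) + ζ(4)` (`multipleZeta_two_mul_two`), Euler's
  `ζ(4) = 4 ζ(3,1)` once more (`multipleZeta_four_eq_four_mul_three_one`);
* in weight `6`: `multipleZeta_two_mul_four_shuffle` — `ζ(2)ζ(4) = ζ(2,4) + 2ζ(3,3) + 4ζ(4,2) + 8ζ(5,1)`
  (`p = 1`, `q = 3`) and `multipleZeta_three_mul_three_shuffle` —
  `ζ(3)² = 2ζ(3,3) + 6ζ(4,2) + 12ζ(5,1)` (`p = q = 2`), the shuffle half of the double shuffle
  relations of weight `6`.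

Together with the harmonic (stuffle) product `ζ(2)ζ(3) = ζ(2,3) + ζ(3,2) + ζ(5)`
(`multipleZeta_mul`, `MultipleZetaStuffle.lean`) the first relation is the *double shuffle
relation* of weight `5`, the input of `hoffmanSpan 5 = mzvSpace 5` (Hoffman's conjecture /
Brown's theorem in weight `5`).

## Method

Euler's partial fractions, organised as the reduction of Tornheim's double series
`W(a,b,c) = ∑_{m,n ≥ 1} m^{-a} n^{-b} (m+n)^{-c}`: from `1/(mn) = (1/m + 1/n)/(m+n)`,
`W(a+1,b+1,c) = W(a,b+1,c+1) + W(a+1,b,c+1)` (`tsum_tornheim_succ_succ`), while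
`W(a,0,c) = W(0,a,c) = ζ(c,a)` (`n₁ = m+n > n₂ = m`; `tsum_tornheim_zero_left/right`) and
`W(a,b,0) = ζ(a)ζ(b)` (`tsum_tornheim_zero_zero`). Everything is computed in `ℝ≥0∞`, in product
coordinates `m = i+1`, `n = j+1` (`(i,j) ∈ ℕ × ℕ`), where rearrangements need no summability
(as in `MultipleZetaDepthTwoProofs.lean`, whose `ofReal_multipleZeta_depth_one/_two` identify the
boundary series with zeta values); the identities return to `ℝ` by `ENNReal.ofReal_eq_ofReal_iff`.
No definition is introduced: `W(a,b,c)` is always written out as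
`∑' p : ℕ × ℕ, ENNReal.ofReal (1 / ((p.1+1)^a (p.2+1)^b (p.1+p.2+2)^c))`.

## References

* M. Eie, *The Theory of Multiple Zeta Values with Applications in Combinatorics*, World
  Scientific (2013), §1.2, Theorem 1.2.3 (Euler's decomposition theorem). [Eie2013]
* M. E. Hoffman, *Multiple harmonic series*, Pacific J. Math. 152 (1992), 275–290, §1 p. 276
  (`A(i₁,i₂) + A(i₂,i₁) = ζ(i₁)ζ(i₂) - ζ(i₁+i₂)`, the harmonic product in depth two). [Hoffman1992]
* J. M. Borwein, D. M. Bradley, *Thirty-two Goldbach variations*, Int. J. Number Theory 2 (2006),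
  65–103, §2 (partial fractions). [BorweinBradley2006]
-/

noncomputable section

open scoped BigOperators ENNReal

namespace Literature.NumberTheory.Transcendental

/-! ### Tornheim's double series `W(a,b,c) = ∑_{m,n ≥ 1} m^{-a} n^{-b} (m+n)^{-c}` in `ℝ≥0∞` -/

/-- Euler's partial fraction step `1/(x^{a+1} y^{b+1} (x+y)^c) =
1/(x^a y^{b+1} (x+y)^{c+1}) + 1/(x^{a+1} y^b (x+y)^{c+1})` (`1/(xy) = (1/x + 1/y)/(x+y)`),
for `x, y > 0`. [folklore] -/
theorem tornheim_summand_succ_succ (a b c : ℕ) {x y : ℝ} (hx : 0 < x) (hy : 0 < y) :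
    1 / (x ^ (a + 1) * y ^ (b + 1) * (x + y) ^ c) =
      1 / (x ^ a * y ^ (b + 1) * (x + y) ^ (c + 1)) +
        1 / (x ^ (a + 1) * y ^ b * (x + y) ^ (c + 1)) := by
  have hxy : 0 < x + y := add_pos hx hy
  field_simp
  ring

/-- **The reduction step** `W(a+1,b+1,c) = W(a,b+1,c+1) + W(a+1,b,c+1)` for Tornheim's double
series, in `ℝ≥0∞` and product coordinates. [folklore] -/
theorem tsum_tornheim_succ_succ (a b c : ℕ) :
    ∑' p : ℕ × ℕ, ENNReal.ofReal
        (1 / (((p.1 : ℝ) + 1) ^ (a + 1) * ((p.2 : ℝ) + 1) ^ (b + 1) * ((p.1 : ℝ) + p.2 + 2) ^ c)) =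
      (∑' p : ℕ × ℕ, ENNReal.ofReal
        (1 / (((p.1 : ℝ) + 1) ^ a * ((p.2 : ℝ) + 1) ^ (b + 1) * ((p.1 : ℝ) + p.2 + 2) ^ (c + 1)))) +
      ∑' p : ℕ × ℕ, ENNReal.ofReal
        (1 / (((p.1 : ℝ) + 1) ^ (a + 1) * ((p.2 : ℝ) + 1) ^ b * ((p.1 : ℝ) + p.2 + 2) ^ (c + 1))) := by
  rw [← ENNReal.tsum_add]
  refine tsum_congr fun p => ?_
  rw [← ENNReal.ofReal_add (by positivity) (by positivity)]
  congr 1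
  have h := tornheim_summand_succ_succ a b c (x := (p.1 : ℝ) + 1) (y := (p.2 : ℝ) + 1)
    (by positivity) (by positivity)
  have e : ((p.1 : ℝ) + 1) + ((p.2 : ℝ) + 1) = (p.1 : ℝ) + p.2 + 2 := by ring
  rw [e] at h
  exact h

/-- Symmetry `W(a,b,c) = W(b,a,c)` (exchange `m ↔ n`). [folklore] -/
theorem tsum_tornheim_comm (a b c : ℕ) :
    ∑' p : ℕ × ℕ, ENNReal.ofReal
        (1 / (((p.1 : ℝ) + 1) ^ a * ((p.2 : ℝ) + 1) ^ b * ((p.1 : ℝ) + p.2 + 2) ^ c)) =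
      ∑' p : ℕ × ℕ, ENNReal.ofReal
        (1 / (((p.1 : ℝ) + 1) ^ b * ((p.2 : ℝ) + 1) ^ a * ((p.1 : ℝ) + p.2 + 2) ^ c)) := by
  rw [← (Equiv.prodComm ℕ ℕ).tsum_eq]
  refine tsum_congr fun p => ?_
  simp only [Equiv.prodComm_apply, Prod.fst_swap, Prod.snd_swap]
  congr 3
  · ring
  · ring

/-- The boundary `W(a,0,c) = ζ(c,a)` (`n₁ = m + n > n₂ = m ≥ 1`), for `c ≥ 2`, `a ≥ 1`.
[folklore] -/
theorem tsum_tornheim_zero_right {a c : ℕ} (hc : 2 ≤ c) (ha : 1 ≤ a) :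
    ∑' p : ℕ × ℕ, ENNReal.ofReal
        (1 / (((p.1 : ℝ) + 1) ^ a * ((p.2 : ℝ) + 1) ^ 0 * ((p.1 : ℝ) + p.2 + 2) ^ c)) =
      ENNReal.ofReal (multipleZeta [c, a]) := by
  rw [ofReal_multipleZeta_depth_two (MZV.isAdmissible_pair hc ha)]
  refine tsum_congr fun p => ?_
  rw [pow_zero, mul_one, mul_comm]

/-- The boundary `W(0,b,c) = ζ(c,b)` (`n₁ = m + n > n₂ = n ≥ 1`), for `c ≥ 2`, `b ≥ 1`.
[folklore] -/
theorem tsum_tornheim_zero_left {b c : ℕ} (hc : 2 ≤ c) (hb : 1 ≤ b) :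
    ∑' p : ℕ × ℕ, ENNReal.ofReal
        (1 / (((p.1 : ℝ) + 1) ^ 0 * ((p.2 : ℝ) + 1) ^ b * ((p.1 : ℝ) + p.2 + 2) ^ c)) =
      ENNReal.ofReal (multipleZeta [c, b]) := by
  rw [tsum_tornheim_comm, tsum_tornheim_zero_right hc hb]

/-- The boundary `W(a,b,0) = ζ(a) ζ(b)` for `a, b ≥ 2` (a product of two convergent series of
nonnegative terms). [folklore] -/
theorem tsum_tornheim_zero_zero {a b : ℕ} (ha : 2 ≤ a) (hb : 2 ≤ b) :
    ∑' p : ℕ × ℕ, ENNReal.ofReal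
        (1 / (((p.1 : ℝ) + 1) ^ a * ((p.2 : ℝ) + 1) ^ b * ((p.1 : ℝ) + p.2 + 2) ^ 0)) =
      ENNReal.ofReal (multipleZeta [a]) * ENNReal.ofReal (multipleZeta [b]) := by
  rw [ofReal_multipleZeta_depth_one ha, ofReal_multipleZeta_depth_one hb, ENNReal.tsum_prod',
    ← ENNReal.tsum_mul_right]
  refine tsum_congr fun m => ?_
  rw [← ENNReal.tsum_mul_left]
  refine tsum_congr fun n => ?_
  rw [← ENNReal.ofReal_mul (by positivity), pow_zero, mul_one, div_mul_div_comm, one_mul]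

/-! ### Euler's decomposition of `ζ(2)ζ(3)` -/

/-- `ζ(2)ζ(3) = ζ(2,3) + 3 ζ(3,2) + 6 ζ(4,1)` in `ℝ≥0∞`: six reduction steps
`W(2,3,0) = W(1,3,1) + W(2,2,1)`, `W(1,3,1) = ζ(2,3) + W(1,2,2)`, `W(2,2,1) = W(1,2,2) + W(2,1,2)`,
`W(1,2,2) = ζ(3,2) + W(1,1,3)`, `W(2,1,2) = W(1,1,3) + ζ(3,2)`, `W(1,1,3) = 2 ζ(4,1)`.
[cite: Eie2013, Theorem 1.2.3] -/
theorem ofReal_multipleZeta_two_mul_three_shuffle :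
    ENNReal.ofReal (multipleZeta [2]) * ENNReal.ofReal (multipleZeta [3]) =
      ENNReal.ofReal (multipleZeta [2, 3]) + 3 * ENNReal.ofReal (multipleZeta [3, 2]) +
        6 * ENNReal.ofReal (multipleZeta [4, 1]) := by
  rw [← tsum_tornheim_zero_zero le_rfl (by norm_num)]
  have h230 := tsum_tornheim_succ_succ 1 2 0
  have h131 := tsum_tornheim_succ_succ 0 2 1
  have h221 := tsum_tornheim_succ_succ 1 1 1
  have h122 := tsum_tornheim_succ_succ 0 1 2
  have h212 := tsum_tornheim_succ_succ 1 0 2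
  have h113 := tsum_tornheim_succ_succ 0 0 3
  have l032 : _ = ENNReal.ofReal (multipleZeta [2, 3]) := tsum_tornheim_zero_left le_rfl (by norm_num)
  have l023 : _ = ENNReal.ofReal (multipleZeta [3, 2]) := tsum_tornheim_zero_left (by norm_num) (by norm_num)
  have l203 : _ = ENNReal.ofReal (multipleZeta [3, 2]) := tsum_tornheim_zero_right (by norm_num) (by norm_num)
  have l014 : _ = ENNReal.ofReal (multipleZeta [4, 1]) := tsum_tornheim_zero_left (by norm_num) le_rfl
  have l104 : _ = ENNReal.ofReal (multipleZeta [4, 1]) := tsum_tornheim_zero_right (by norm_num) le_rfl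
  simp only [zero_add] at h230 h131 h221 h122 h212 h113
  rw [l032] at h131
  rw [l023] at h122
  rw [l203] at h212
  rw [l014, l104] at h113
  rw [h230, h131, h221, h122, h212, h113]
  ring

/-- **Euler's decomposition (shuffle) formula in weight `5`**:
`ζ(2) ζ(3) = ζ(2,3) + 3 ζ(3,2) + 6 ζ(4,1)` — Eie 2013, Theorem 1.2.3 with `p = 1`, `q = 2`
(there in the increasing convention: `ζ(2)ζ(3) = ζ(3,2) + 3ζ(2,3) + 6ζ(1,4)`).
[cite: Eie2013, Theorem 1.2.3] -/
theorem multipleZeta_two_mul_three_shuffle :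
    multipleZeta [2] * multipleZeta [3] =
      multipleZeta [2, 3] + 3 * multipleZeta [3, 2] + 6 * multipleZeta [4, 1] := by
  have p2 := (multipleZeta_pos_of_isAdmissible_holds
    (MZV.isAdmissible_singleton_of_two_le le_rfl)).le
  have p3 := (multipleZeta_pos_of_isAdmissible_holds
    (MZV.isAdmissible_singleton_of_two_le (by norm_num : 2 ≤ 3))).le
  have p23 := (multipleZeta_pos_of_isAdmissible_holds
    (MZV.isAdmissible_pair le_rfl (by norm_num : 1 ≤ 3))).le
  have p32 := (multipleZeta_pos_of_isAdmissible_holds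
    (MZV.isAdmissible_pair (by norm_num : 2 ≤ 3) (by norm_num : 1 ≤ 2))).le
  have p41 := (multipleZeta_pos_of_isAdmissible_holds
    (MZV.isAdmissible_pair (by norm_num : 2 ≤ 4) le_rfl)).le
  have h := ofReal_multipleZeta_two_mul_three_shuffle
  rw [← ENNReal.ofReal_mul p2, show (3 : ℝ≥0∞) = ENNReal.ofReal 3 by norm_num,
    show (6 : ℝ≥0∞) = ENNReal.ofReal 6 by norm_num,
    ← ENNReal.ofReal_mul (by norm_num), ← ENNReal.ofReal_mul (by norm_num),
    ← ENNReal.ofReal_add p23 (by positivity), ← ENNReal.ofReal_add (by positivity) (by positivity),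
    ENNReal.ofReal_eq_ofReal_iff (mul_nonneg p2 p3) (by positivity)] at h
  exact h

/-! ### Euler's decomposition of `ζ(2)ζ(2)` -/

/-- `ζ(2)ζ(2) = 2 ζ(2,2) + 4 ζ(3,1)` in `ℝ≥0∞`: `W(2,2,0) = W(1,2,1) + W(2,1,1)`,
`W(1,2,1) = ζ(2,2) + W(1,1,2)`, `W(2,1,1) = W(1,1,2) + ζ(2,2)`, `W(1,1,2) = 2 ζ(3,1)`.
[cite: Eie2013, Theorem 1.2.3] -/
theorem ofReal_multipleZeta_two_mul_two_shuffle :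
    ENNReal.ofReal (multipleZeta [2]) * ENNReal.ofReal (multipleZeta [2]) =
      2 * ENNReal.ofReal (multipleZeta [2, 2]) + 4 * ENNReal.ofReal (multipleZeta [3, 1]) := by
  rw [← tsum_tornheim_zero_zero le_rfl le_rfl]
  have h220 := tsum_tornheim_succ_succ 1 1 0
  have h121 := tsum_tornheim_succ_succ 0 1 1
  have h211 := tsum_tornheim_succ_succ 1 0 1
  have h112 := tsum_tornheim_succ_succ 0 0 2
  have l022 : _ = ENNReal.ofReal (multipleZeta [2, 2]) := tsum_tornheim_zero_left le_rfl (by norm_num)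
  have l202 : _ = ENNReal.ofReal (multipleZeta [2, 2]) := tsum_tornheim_zero_right le_rfl (by norm_num)
  have l013 : _ = ENNReal.ofReal (multipleZeta [3, 1]) := tsum_tornheim_zero_left (by norm_num) le_rfl
  have l103 : _ = ENNReal.ofReal (multipleZeta [3, 1]) := tsum_tornheim_zero_right (by norm_num) le_rfl
  simp only [zero_add] at h220 h121 h211 h112
  rw [l022] at h121
  rw [l202] at h211
  rw [l013, l103] at h112
  rw [h220, h121, h211, h112]
  ring

/-- **Euler's decomposition (shuffle) formula in weight `4`**: `ζ(2) ζ(2) = 2 ζ(2,2) + 4 ζ(3,1)`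
— Eie 2013, Theorem 1.2.3 with `p = q = 1`. [cite: Eie2013, Theorem 1.2.3] -/
theorem multipleZeta_two_mul_two_shuffle :
    multipleZeta [2] * multipleZeta [2] = 2 * multipleZeta [2, 2] + 4 * multipleZeta [3, 1] := by
  have p2 := (multipleZeta_pos_of_isAdmissible_holds
    (MZV.isAdmissible_singleton_of_two_le le_rfl)).le
  have p22 := (multipleZeta_pos_of_isAdmissible_holds
    (MZV.isAdmissible_pair le_rfl (by norm_num : 1 ≤ 2))).le
  have p31 := (multipleZeta_pos_of_isAdmissible_holds
    (MZV.isAdmissible_pair (by norm_num : 2 ≤ 3) le_rfl)).le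
  have h := ofReal_multipleZeta_two_mul_two_shuffle
  rw [← ENNReal.ofReal_mul p2, show (2 : ℝ≥0∞) = ENNReal.ofReal 2 by norm_num,
    show (4 : ℝ≥0∞) = ENNReal.ofReal 4 by norm_num,
    ← ENNReal.ofReal_mul (by norm_num), ← ENNReal.ofReal_mul (by norm_num),
    ← ENNReal.ofReal_add (by positivity) (by positivity),
    ENNReal.ofReal_eq_ofReal_iff (mul_nonneg p2 p2) (by positivity)] at h
  exact h

/-- Comparing the shuffle `ζ(2)² = 2ζ(2,2) + 4ζ(3,1)` with the stuffle `ζ(2)² = 2ζ(2,2) + ζ(4)`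
(`multipleZeta_two_mul_two`): `ζ(4) = 4 ζ(3,1)` (Euler; the double shuffle relation of weight
`4`). [cite: Eie2013, Theorem 1.2.3] -/
theorem multipleZeta_four_eq_four_mul_three_one : multipleZeta [4] = 4 * multipleZeta [3, 1] := by
  have h1 := multipleZeta_two_mul_two_shuffle
  have h2 := multipleZeta_two_mul_two
  linarith

/-! ### Euler's decomposition of `ζ(2)ζ(4)` and `ζ(3)ζ(3)` (weight `6`) -/

/-- `ζ(2)ζ(4) = ζ(2,4) + 2ζ(3,3) + 4ζ(4,2) + 8ζ(5,1)` in `ℝ≥0∞` (eight reduction steps from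
`W(2,4,0)`). [cite: Eie2013, Theorem 1.2.3] -/
theorem ofReal_multipleZeta_two_mul_four_shuffle :
    ENNReal.ofReal (multipleZeta [2]) * ENNReal.ofReal (multipleZeta [4]) =
      ENNReal.ofReal (multipleZeta [2, 4]) + 2 * ENNReal.ofReal (multipleZeta [3, 3]) +
        4 * ENNReal.ofReal (multipleZeta [4, 2]) + 8 * ENNReal.ofReal (multipleZeta [5, 1]) := by
  rw [← tsum_tornheim_zero_zero le_rfl (by norm_num)]
  have h240 := tsum_tornheim_succ_succ 1 3 0
  have h141 := tsum_tornheim_succ_succ 0 3 1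
  have h231 := tsum_tornheim_succ_succ 1 2 1
  have h132 := tsum_tornheim_succ_succ 0 2 2
  have h222 := tsum_tornheim_succ_succ 1 1 2
  have h123 := tsum_tornheim_succ_succ 0 1 3
  have h213 := tsum_tornheim_succ_succ 1 0 3
  have h114 := tsum_tornheim_succ_succ 0 0 4
  have l042 : _ = ENNReal.ofReal (multipleZeta [2, 4]) := tsum_tornheim_zero_left le_rfl (by norm_num)
  have l033 : _ = ENNReal.ofReal (multipleZeta [3, 3]) :=
    tsum_tornheim_zero_left (by norm_num) (by norm_num)
  have l024 : _ = ENNReal.ofReal (multipleZeta [4, 2]) :=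
    tsum_tornheim_zero_left (by norm_num) (by norm_num)
  have l204 : _ = ENNReal.ofReal (multipleZeta [4, 2]) :=
    tsum_tornheim_zero_right (by norm_num) (by norm_num)
  have l015 : _ = ENNReal.ofReal (multipleZeta [5, 1]) := tsum_tornheim_zero_left (by norm_num) le_rfl
  have l105 : _ = ENNReal.ofReal (multipleZeta [5, 1]) := tsum_tornheim_zero_right (by norm_num) le_rfl
  simp only [zero_add] at h240 h141 h231 h132 h222 h123 h213 h114
  rw [l042] at h141
  rw [l033] at h132
  rw [l024] at h123
  rw [l204] at h213
  rw [l015, l105] at h114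
  rw [h240, h141, h231, h132, h222, h123, h213, h114]
  ring

/-- **Euler's decomposition (shuffle) formula in weight `6`, `ζ(2)ζ(4)`**:
`ζ(2)ζ(4) = ζ(2,4) + 2ζ(3,3) + 4ζ(4,2) + 8ζ(5,1)` — Eie 2013, Theorem 1.2.3 with `p = 1`, `q = 3`
(coefficients `binom(α₂,3) + binom(α₂,1)` for `α₂ = 1, 2, 3, 4`). [cite: Eie2013, Theorem 1.2.3] -/
theorem multipleZeta_two_mul_four_shuffle :
    multipleZeta [2] * multipleZeta [4] =
      multipleZeta [2, 4] + 2 * multipleZeta [3, 3] + 4 * multipleZeta [4, 2] +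
        8 * multipleZeta [5, 1] := by
  have p2 := (multipleZeta_pos_of_isAdmissible_holds
    (MZV.isAdmissible_singleton_of_two_le le_rfl)).le
  have p4 := (multipleZeta_pos_of_isAdmissible_holds
    (MZV.isAdmissible_singleton_of_two_le (by norm_num : 2 ≤ 4))).le
  have p24 := (multipleZeta_pos_of_isAdmissible_holds
    (MZV.isAdmissible_pair le_rfl (by norm_num : 1 ≤ 4))).le
  have p33 := (multipleZeta_pos_of_isAdmissible_holds
    (MZV.isAdmissible_pair (by norm_num : 2 ≤ 3) (by norm_num : 1 ≤ 3))).le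
  have p42 := (multipleZeta_pos_of_isAdmissible_holds
    (MZV.isAdmissible_pair (by norm_num : 2 ≤ 4) (by norm_num : 1 ≤ 2))).le
  have p51 := (multipleZeta_pos_of_isAdmissible_holds
    (MZV.isAdmissible_pair (by norm_num : 2 ≤ 5) le_rfl)).le
  have h := ofReal_multipleZeta_two_mul_four_shuffle
  rw [← ENNReal.ofReal_mul p2, show (2 : ℝ≥0∞) = ENNReal.ofReal 2 by norm_num,
    show (4 : ℝ≥0∞) = ENNReal.ofReal 4 by norm_num, show (8 : ℝ≥0∞) = ENNReal.ofReal 8 by norm_num,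
    ← ENNReal.ofReal_mul (by norm_num), ← ENNReal.ofReal_mul (by norm_num),
    ← ENNReal.ofReal_mul (by norm_num),
    ← ENNReal.ofReal_add p24 (by positivity), ← ENNReal.ofReal_add (by positivity) (by positivity),
    ← ENNReal.ofReal_add (by positivity) (by positivity),
    ENNReal.ofReal_eq_ofReal_iff (mul_nonneg p2 p4) (by positivity)] at h
  exact h

/-- `ζ(3)ζ(3) = 2ζ(3,3) + 6ζ(4,2) + 12ζ(5,1)` in `ℝ≥0∞` (reduction from `W(3,3,0)`, using the
symmetry `W(3,2,1) = W(2,3,1)`). [cite: Eie2013, Theorem 1.2.3] -/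
theorem ofReal_multipleZeta_three_mul_three_shuffle :
    ENNReal.ofReal (multipleZeta [3]) * ENNReal.ofReal (multipleZeta [3]) =
      2 * ENNReal.ofReal (multipleZeta [3, 3]) + 6 * ENNReal.ofReal (multipleZeta [4, 2]) +
        12 * ENNReal.ofReal (multipleZeta [5, 1]) := by
  rw [← tsum_tornheim_zero_zero (by norm_num) (by norm_num)]
  have h330 := tsum_tornheim_succ_succ 2 2 0
  have h321 := tsum_tornheim_comm 3 2 1
  have h231 := tsum_tornheim_succ_succ 1 2 1
  have h132 := tsum_tornheim_succ_succ 0 2 2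
  have h222 := tsum_tornheim_succ_succ 1 1 2
  have h123 := tsum_tornheim_succ_succ 0 1 3
  have h213 := tsum_tornheim_succ_succ 1 0 3
  have h114 := tsum_tornheim_succ_succ 0 0 4
  have l033 : _ = ENNReal.ofReal (multipleZeta [3, 3]) :=
    tsum_tornheim_zero_left (by norm_num) (by norm_num)
  have l024 : _ = ENNReal.ofReal (multipleZeta [4, 2]) :=
    tsum_tornheim_zero_left (by norm_num) (by norm_num)
  have l204 : _ = ENNReal.ofReal (multipleZeta [4, 2]) :=
    tsum_tornheim_zero_right (by norm_num) (by norm_num)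
  have l015 : _ = ENNReal.ofReal (multipleZeta [5, 1]) := tsum_tornheim_zero_left (by norm_num) le_rfl
  have l105 : _ = ENNReal.ofReal (multipleZeta [5, 1]) := tsum_tornheim_zero_right (by norm_num) le_rfl
  simp only [zero_add] at h330 h231 h132 h222 h123 h213 h114
  rw [l033] at h132
  rw [l024] at h123
  rw [l204] at h213
  rw [l015, l105] at h114
  rw [h330, h321, h231, h132, h222, h123, h213, h114]
  ring

/-- **Euler's decomposition (shuffle) formula in weight `6`, `ζ(3)ζ(3)`**:
`ζ(3)² = 2ζ(3,3) + 6ζ(4,2) + 12ζ(5,1)` — Eie 2013, Theorem 1.2.3 with `p = q = 2`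
(coefficients `2 binom(α₂,2)` for `α₂ = 2, 3, 4`). [cite: Eie2013, Theorem 1.2.3] -/
theorem multipleZeta_three_mul_three_shuffle :
    multipleZeta [3] * multipleZeta [3] =
      2 * multipleZeta [3, 3] + 6 * multipleZeta [4, 2] + 12 * multipleZeta [5, 1] := by
  have p3 := (multipleZeta_pos_of_isAdmissible_holds
    (MZV.isAdmissible_singleton_of_two_le (by norm_num : 2 ≤ 3))).le
  have p33 := (multipleZeta_pos_of_isAdmissible_holds
    (MZV.isAdmissible_pair (by norm_num : 2 ≤ 3) (by norm_num : 1 ≤ 3))).le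
  have p42 := (multipleZeta_pos_of_isAdmissible_holds
    (MZV.isAdmissible_pair (by norm_num : 2 ≤ 4) (by norm_num : 1 ≤ 2))).le
  have p51 := (multipleZeta_pos_of_isAdmissible_holds
    (MZV.isAdmissible_pair (by norm_num : 2 ≤ 5) le_rfl)).le
  have h := ofReal_multipleZeta_three_mul_three_shuffle
  rw [← ENNReal.ofReal_mul p3, show (2 : ℝ≥0∞) = ENNReal.ofReal 2 by norm_num,
    show (6 : ℝ≥0∞) = ENNReal.ofReal 6 by norm_num, show (12 : ℝ≥0∞) = ENNReal.ofReal 12 by norm_num,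
    ← ENNReal.ofReal_mul (by norm_num), ← ENNReal.ofReal_mul (by norm_num),
    ← ENNReal.ofReal_mul (by norm_num),
    ← ENNReal.ofReal_add (by positivity) (by positivity),
    ← ENNReal.ofReal_add (by positivity) (by positivity),
    ENNReal.ofReal_eq_ofReal_iff (mul_nonneg p3 p3) (by positivity)] at h
  exact h

end Literature.NumberTheory.Transcendental
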